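import Literature.MathematicalPhysics.QuantumFieldTheory.Balaban1983to89.B9DirSupHolderAtPins
import Literature.MathematicalPhysics.QuantumFieldTheory.Balaban1983to89.Node00.OpsYDirTranspose
import Literature.MathematicalPhysics.QuantumFieldTheory.Balaban1983to89.B9CoReadingCoordsHolderSAdm
import Literature.MathematicalPhysics.QuantumFieldTheory.Balaban1983to89.B9CoReadingCoordsHolderAdm
import Literature.MathematicalPhysics.QuantumFieldTheory.Balaban1983to89.B9DirSupSqAtPinsA

/-!
# BalabanUVNodes ∕ N06 ([B9], `Dag.B9_main`) — THE SIX KINEMATIC CONJUNCTS OF ROWS 18–19 (`DirTranspose37 ∕ DirSupHolder37 ∕ DirSup37` in `h36H`,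
# `DirTranspose310 ∕ DirSupHolder310 ∕ DirSup310` in `h36HA`) ARE THEOREMS OF THE CERTIFICATE'S PINS — knit of dag-n06-w5's slice relabelling
# (`B9DirSupAtPins`, `B9DirSupHolderAtPins`) and node00-def-Y's L² adjoints (`Node00.OpsYDirTranspose`) at dag-n06-w6's CUT probe carriers

Track A of `YM-PLAN.md` (cell `pub-ymgap`, HUMAN RULING D-0062), node **N06** = [Balaban1985BackgroundPropagators] Thms 3.1–3.15; seat `pub-ymgap-dag-n06-d`
(s2, «knit N06 at the ₁₁ record»), gen 11.  A HELPER for the stage-11 certificate editions ≥ 30.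

WHAT.  Rows 18–19 of the certificate (Theorem 3.7 ∕ Corollary 3.8 for `G′(U)`, Theorem 3.10 for `G(U)`; dag-n06-k's `rows131819_definite_geo9Y_pairM`) display,
inside the leg ∕ factor schema binders `h36H` ∕ `h36HA`, three purely KINEMATIC conjuncts per sector: `DirTranspose37 (𝔬 x) (𝔡 x) U` (∇\*_{U,μ} is the L²
transpose of ∇_{U,μ}, [B9] p. 391 + (3.8) p. 392), `DirSupHolder37 (𝔬 x) (𝔡 x) (𝔭 x) R H U` and `DirSup37 (𝔬 x) (𝔡 x) R H U` (a two-space majorant of the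
bundled `∇_U∘T` ∕ `T∘∇*_U` majorises every direction component, for slice-constant `T`), and the `310` twins.  All six are theorems of the certificate's own pin
equations: dag-n06-w5 proved `dirSup37_pins ∕ dirSup310_pins` (p613379) and the carrier-generic `dirSupHolder37_of_pins ∕ dirSupHolder310_of_pins` (p615433);
node00-def-Y proved `dirTranspose37_memberY ∕ dirTranspose310_memberY` (p613909; the (3.35) class makes `U` SU(N)-valued, hence unitary).  THIS FILE (§1)
instantiates the Hölder-probe transfer at dag-n06-w6's CUT probe carriers `holderProbesSA` ∕ `holderProbesKA` (`B9CoReadingCoordsHolderSAdm ∕ …Adm`, node00-def-Y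
ruling «the (3.40) cut belongs in the pin carrier»; same `probeK b g w w₀` shape as `holderProbesS ∕ holderProbesK`, weights `wSA ∕ wKA`), and (§2) knits, in the
certificate's member-∀ binder shape with the eight leg ∕ factor conjuncts ABSTRACT (`P₁ … P₈ : ∀ x, Cfg → Prop`, so the knit survives every re-typing of the legs),
★★ `h36H_of_dir_pins` ∕ `h36HA_of_dir_pins`: the displayed binder WITH the three kinematic conjuncts from the same binder WITHOUT them + the pins
`h𝔭 hblkS hblkYS hGpS hDS hDsS h𝔡d h𝔡s` (resp. `h𝔭A hblkA hblkYA hGcoA hDcoA hDscoA h𝔡Ad h𝔡As`).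
HONEST FRAMING.  Kernel bookkeeping (six applications per member and configuration); COUNT-NEUTRAL; nothing of [B9]'s estimates asserted; N06 NOT discharged.
One finite 𝕋⁴ programme at fixed `ε` — NOT continuum, NOT OS, NOT the mass gap ∕ Clay.  0 `def`, 0 `sorry`.
-/

noncomputable section

namespace Summit.QuantumFields.YangMills.BalabanUVNodes.N06DirKinematicsAtPins

open Literature.MathematicalPhysics.QuantumFieldTheory.Balaban1983to89
open Literature.MathematicalPhysics.QuantumFieldTheory.Balaban1983to89.Node00 (SiteY FBondY IBondY SiteOpY SiteParY BondOpY BondParY etaS)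
open Literature.MathematicalPhysics.QuantumFieldTheory.Balaban1983to89.Node00.OpsYDirTranspose (dirTranspose37_memberY dirTranspose310_memberY)
open Literature.MathematicalPhysics.QuantumFieldTheory.Balaban1983to89.B9Thm37Whole (Ops)
open Literature.MathematicalPhysics.QuantumFieldTheory.Balaban1983to89.B9Thm310Whole (Ops310)
open Literature.MathematicalPhysics.QuantumFieldTheory.Balaban1983to89.B9RWSums346SecondDiffGp (DirOps37 DirTranspose37)
open Literature.MathematicalPhysics.QuantumFieldTheory.Balaban1983to89.B9RWSums346SecondDiff (DirOps310 DirTranspose310)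
open Literature.MathematicalPhysics.QuantumFieldTheory.Balaban1983to89.B9RWSums346MixedPair (DirSup37 DirSup310)
open Literature.MathematicalPhysics.QuantumFieldTheory.Balaban1983to89.B9RWSums344InputPair (DirSupHolder37 DirSupHolder310)
open Literature.MathematicalPhysics.QuantumFieldTheory.Balaban1983to89.B9RWSums343Holder (HolderProbes)
open Literature.MathematicalPhysics.QuantumFieldTheory.Balaban1983to89.B9GeoNormsKLevelV1 (geo9K)
open Literature.MathematicalPhysics.QuantumFieldTheory.Balaban1983to89.B9CoReadingCoords (coordOpK XBK blkBK GcoK DcoK DscoK cdBₗ cdsBₗ)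
open Literature.MathematicalPhysics.QuantumFieldTheory.Balaban1983to89.B9CoReadingCoordsS (XSK blkSK sIK GcoS DcoS DscoS)
open Literature.MathematicalPhysics.QuantumFieldTheory.Balaban1983to89.B9CoReadingCoordsHolder (PK wK w₀K)
open Literature.MathematicalPhysics.QuantumFieldTheory.Balaban1983to89.B9CoReadingCoordsHolderS (wS)
open Literature.MathematicalPhysics.QuantumFieldTheory.Balaban1983to89.B9CoReadingCoordsHolderSAdm (wSA holderProbesSA)
open Literature.MathematicalPhysics.QuantumFieldTheory.Balaban1983to89.B9CoReadingCoordsHolderAdm (wKA holderProbesKA)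
open Literature.MathematicalPhysics.QuantumFieldTheory.Balaban1983to89.B9CoReadingCoordsTranspose (TrIdx trBasis)
open Literature.MathematicalPhysics.QuantumFieldTheory.Balaban1983to89.B9Ineq349SiteComposite (cdSL cdsSL)
open Literature.MathematicalPhysics.QuantumFieldTheory.Balaban1983to89.B9DirSupAtPins (dirSup37_pins dirSup310_pins)
open Literature.MathematicalPhysics.QuantumFieldTheory.Balaban1983to89.B9DirSupHolderAtPins (dirSupHolder37_of_pins dirSupHolder310_of_pins)
open Literature.MathematicalPhysics.QuantumFieldTheory.Balaban1983to89.B9PinMembersKLevelV1 (MemberY geo9Y bg9Y)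
open Literature.MathematicalPhysics.QuantumFieldTheory.Balaban1983to89.B7Prop2SpecialUnitary (specialUnitaryUnits)
open scoped Matrix.Norms.L2Operator

variable {N : ℕ}
variable {d ℓ : ℕ} {hd : 1 ≤ d + 1} {hL : Odd (ℓ + 1) ∧ 1 < ℓ + 1} {b₀ b₁ : ℝ} {Mstar : ℕ}
variable [∀ x : MemberY d ℓ hd hL b₀ b₁ Mstar, Fintype (geo9Y x).Site]

/-! ## §1 The Hölder-probe direction transfer at dag-n06-w6's CUT probe carriers -/

/-- ★ **`DirSupHolder37 (𝔬 x) (𝔡 x) (𝔭 x) R H U` AT THE PINS WITH THE CUT SITE PROBE CARRIER `holderProbesSA`** (dag-n06-w5's carrier-generic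
`dirSupHolder37_of_pins` at `g = U(Γ_{·,·})`, `w = wSA β`, `w₀ = 1`, anchors `blkPK (sIK bI)`). [cite: Balaban1985BackgroundPropagators, (3.43) p.398 + (3.39)–(3.40) p.397; Balaban1984PropagatorsII, (2.51) p.232] -/
theorem dirSupHolder37_pinsSA (x : MemberY d ℓ hd hL b₀ b₁ Mstar) {ι : Type}
    (𝔬 : Ops (geo9Y x) (bg9Y (Matrix (Fin N) (Fin N) ℂ) (specialUnitaryUnits (Fin N)) x) (XSK (TrIdx N) x.toKIdx) (XSK (TrIdx N) x.toKIdx) ι)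
    (𝔡 : DirOps37 𝔬 (Fin (d + 1)))
    (𝔭 : HolderProbes (geo9Y x) (bg9Y (Matrix (Fin N) (Fin N) ℂ) (specialUnitaryUnits (Fin N)) x) (XSK (TrIdx N) x.toKIdx) (XSK (TrIdx N) x.toKIdx)
      (PK (SiteY x.toKIdx) (Fin (d + 1)) (TrIdx N)) (PK (SiteY x.toKIdx) (Fin (d + 1)) (TrIdx N)))
    {bI : FBondY x.toKIdx → IBondY x.toKIdx} (Gp : SiteOpY (Matrix (Fin N) (Fin N) ℂ) x.toKIdx) (parS : SiteParY (Matrix (Fin N) (Fin N) ℂ) x.toKIdx)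
    (h𝔭 : 𝔭 = holderProbesSA x.toKIdx (trBasis N) (bg9Y (Matrix (Fin N) (Fin N) ℂ) (specialUnitaryUnits (Fin N)) x) (fun U => U) parS bI)
    (hblkS : 𝔬.blk = blkSK x.toKIdx (sIK x.toKIdx bI)) {U : (bg9Y (Matrix (Fin N) (Fin N) ℂ) (specialUnitaryUnits (Fin N)) x).Cfg}
    (hGpS : 𝔬.Gp U = GcoS x.toKIdx (trBasis N) (bg9Y (Matrix (Fin N) (Fin N) ℂ) (specialUnitaryUnits (Fin N)) x) (fun U => U) Gp U)
    (hDS : 𝔬.D U = DcoS x.toKIdx (trBasis N) (bg9Y (Matrix (Fin N) (Fin N) ℂ) (specialUnitaryUnits (Fin N)) x) (fun U => U) U)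
    (h𝔡d : 𝔡.Dd U = fun μ => (etaS x.toKIdx)⁻¹ • coordOpK (trBasis N) (fun _ : Fin (d + 1) => (cdSL x.toKIdx U μ).restrictScalars ℝ))
    {R : ℝ} {H : Prop} : DirSupHolder37 𝔬 𝔡 𝔭 R H U := by
  letI : Fintype (geo9K x.toKIdx).Site := (inferInstance : Fintype (geo9Y x).Site)
  subst h𝔭
  exact dirSupHolder37_of_pins x.toKIdx (trBasis N) (bg9Y (Matrix (Fin N) (Fin N) ℂ) (specialUnitaryUnits (Fin N)) x) (fun U => U) Gp 𝔬 𝔡 _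
    (fun U z z' => parS U z z') (fun β => wSA x.toKIdx β) (fun _ _ => (1 : ℝ)) hblkS (fun β => rfl) (fun β => rfl) rfl rfl
    hGpS hDS h𝔡d

/-- ★ **`DirSupHolder310 (𝔬A x) (𝔡A x) (𝔭A x) R H U` AT THE PINS WITH THE CUT BOND PROBE CARRIER `holderProbesKA`** (dag-n06-w5's carrier-generic
`dirSupHolder310_of_pins` at `g = U(Γ_{·,·})`, `w = wKA β`, `w₀ = w₀K β`, anchors `blkPK bI`). [cite: Balaban1985BackgroundPropagators, (3.43) p.398 + (3.39)–(3.40) p.397 + Thm 3.10 p.416; Balaban1984PropagatorsII, (2.51) p.232] -/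
theorem dirSupHolder310_pinsKA (x : MemberY d ℓ hd hL b₀ b₁ Mstar) {ι A : Type}
    (𝔬 : Ops310 (geo9Y x) (bg9Y (Matrix (Fin N) (Fin N) ℂ) (specialUnitaryUnits (Fin N)) x) (XBK (TrIdx N) x.toKIdx) (XBK (TrIdx N) x.toKIdx) ι A)
    (𝔡 : DirOps310 𝔬 (Fin (d + 1)))
    (𝔭 : HolderProbes (geo9Y x) (bg9Y (Matrix (Fin N) (Fin N) ℂ) (specialUnitaryUnits (Fin N)) x) (XBK (TrIdx N) x.toKIdx) (XBK (TrIdx N) x.toKIdx)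
      (PK (FBondY x.toKIdx) (Fin (d + 1)) (TrIdx N)) (PK (FBondY x.toKIdx) (Fin (d + 1)) (TrIdx N)))
    {bI : FBondY x.toKIdx → IBondY x.toKIdx} (GA : BondOpY (Matrix (Fin N) (Fin N) ℂ) x.toKIdx) (parB : BondParY (Matrix (Fin N) (Fin N) ℂ) x.toKIdx)
    (h𝔭A : 𝔭 = holderProbesKA x.toKIdx (trBasis N) (bg9Y (Matrix (Fin N) (Fin N) ℂ) (specialUnitaryUnits (Fin N)) x) (fun U => U) parB bI)
    (hblkA : 𝔬.blk = blkBK x.toKIdx bI) {U : (bg9Y (Matrix (Fin N) (Fin N) ℂ) (specialUnitaryUnits (Fin N)) x).Cfg}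
    (hGcoA : 𝔬.G U = GcoK x.toKIdx (trBasis N) (bg9Y (Matrix (Fin N) (Fin N) ℂ) (specialUnitaryUnits (Fin N)) x) (fun U => U) GA U)
    (hDcoA : 𝔬.D U = DcoK x.toKIdx (trBasis N) (bg9Y (Matrix (Fin N) (Fin N) ℂ) (specialUnitaryUnits (Fin N)) x) (fun U => U) U)
    (h𝔡Ad : 𝔡.Dd U = fun μ => coordOpK (trBasis N) (fun _ : Fin (d + 1) => cdBₗ x.toKIdx U μ))
    {R : ℝ} {H : Prop} : DirSupHolder310 𝔬 𝔡 𝔭 R H U := by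
  letI : Fintype (geo9K x.toKIdx).Site := (inferInstance : Fintype (geo9Y x).Site)
  subst h𝔭A
  exact dirSupHolder310_of_pins x.toKIdx (trBasis N) (bg9Y (Matrix (Fin N) (Fin N) ℂ) (specialUnitaryUnits (Fin N)) x) (fun U => U) GA 𝔬 𝔡 _
    (fun U f f' => parB U f.src f'.src) (fun β => wKA x.toKIdx β) (fun β => w₀K x.toKIdx β) hblkA
    (fun β => rfl) (fun β => rfl) rfl rfl hGcoA hDcoA h𝔡Ad

/-! ## §2 The member-∀ knit: the certificate's `h36H` ∕ `h36HA` WITH the kinematic conjuncts from the binder WITHOUT them -/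

/-- ★★ **`h36H` WITH `DirTranspose37 ∕ DirSupHolder37 ∕ DirSup37` FROM `h36H` WITHOUT THEM + THE PINS** (leg ∕ factor conjuncts `P₁ … P₈` abstract; the premiss chain
is the certificate's «`M₁ ≤ M_x`, `0 < α₀`, `c·M_x·α₀ ≤ a₁`, `U` in the class (3.35)»; cut site probe carrier `holderProbesSA`).
[cite: Balaban1985BackgroundPropagators, p.391 + (3.8) p.392 (adjoints), (3.39)–(3.40) p.397, (3.42)–(3.43) pp.397–398, (3.46) p.398, (3.35) p.396; Balaban1984PropagatorsII, (2.51) p.232] -/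
theorem h36H_of_dir_pins {ι : MemberY d ℓ hd hL b₀ b₁ Mstar → Type}
    (𝔬 : ∀ x : MemberY d ℓ hd hL b₀ b₁ Mstar,
      Ops (geo9Y x) (bg9Y (Matrix (Fin N) (Fin N) ℂ) (specialUnitaryUnits (Fin N)) x) (XSK (TrIdx N) x.toKIdx) (XSK (TrIdx N) x.toKIdx) (ι x))
    (𝔡 : ∀ x : MemberY d ℓ hd hL b₀ b₁ Mstar, DirOps37 (𝔬 x) (Fin (d + 1)))
    (𝔭 : ∀ x : MemberY d ℓ hd hL b₀ b₁ Mstar, HolderProbes (geo9Y x) (bg9Y (Matrix (Fin N) (Fin N) ℂ) (specialUnitaryUnits (Fin N)) x) (XSK (TrIdx N) x.toKIdx)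
      (XSK (TrIdx N) x.toKIdx) (PK (SiteY x.toKIdx) (Fin (d + 1)) (TrIdx N)) (PK (SiteY x.toKIdx) (Fin (d + 1)) (TrIdx N)))
    {bI : ∀ x : MemberY d ℓ hd hL b₀ b₁ Mstar, FBondY x.toKIdx → IBondY x.toKIdx}
    (Gp : ∀ x : MemberY d ℓ hd hL b₀ b₁ Mstar, SiteOpY (Matrix (Fin N) (Fin N) ℂ) x.toKIdx)
    (parS : ∀ x : MemberY d ℓ hd hL b₀ b₁ Mstar, SiteParY (Matrix (Fin N) (Fin N) ℂ) x.toKIdx)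
    (h𝔭 : ∀ x : MemberY d ℓ hd hL b₀ b₁ Mstar,
      𝔭 x = holderProbesSA x.toKIdx (trBasis N) (bg9Y (Matrix (Fin N) (Fin N) ℂ) (specialUnitaryUnits (Fin N)) x) (fun U => U) (parS x) (bI x))
    (hblkS : ∀ x : MemberY d ℓ hd hL b₀ b₁ Mstar, (𝔬 x).blk = blkSK x.toKIdx (sIK x.toKIdx (bI x)))
    (hblkYS : ∀ x : MemberY d ℓ hd hL b₀ b₁ Mstar, (𝔬 x).blkY = blkSK x.toKIdx (sIK x.toKIdx (bI x)))
    (hGpS : ∀ (x : MemberY d ℓ hd hL b₀ b₁ Mstar) U,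
      (𝔬 x).Gp U = GcoS x.toKIdx (trBasis N) (bg9Y (Matrix (Fin N) (Fin N) ℂ) (specialUnitaryUnits (Fin N)) x) (fun U => U) (Gp x) U)
    (hDS : ∀ (x : MemberY d ℓ hd hL b₀ b₁ Mstar) U, (𝔬 x).D U = DcoS x.toKIdx (trBasis N) (bg9Y (Matrix (Fin N) (Fin N) ℂ) (specialUnitaryUnits (Fin N)) x) (fun U => U) U)
    (hDsS : ∀ (x : MemberY d ℓ hd hL b₀ b₁ Mstar) U,
      (𝔬 x).Dstar U = DscoS x.toKIdx (trBasis N) (bg9Y (Matrix (Fin N) (Fin N) ℂ) (specialUnitaryUnits (Fin N)) x) (fun U => U) U)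
    (h𝔡d : ∀ (x : MemberY d ℓ hd hL b₀ b₁ Mstar) (U : (bg9Y (Matrix (Fin N) (Fin N) ℂ) (specialUnitaryUnits (Fin N)) x).Cfg),
      (𝔡 x).Dd U = fun μ => (etaS x.toKIdx)⁻¹ • coordOpK (trBasis N) (fun _ : Fin (d + 1) => (cdSL x.toKIdx U μ).restrictScalars ℝ))
    (h𝔡s : ∀ (x : MemberY d ℓ hd hL b₀ b₁ Mstar) (U : (bg9Y (Matrix (Fin N) (Fin N) ℂ) (specialUnitaryUnits (Fin N)) x).Cfg),
      (𝔡 x).Dsd U = fun μ => (etaS x.toKIdx)⁻¹ • coordOpK (trBasis N) (fun _ : Fin (d + 1) => (cdsSL x.toKIdx U μ).restrictScalars ℝ))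
    {M₁ a₁ c R : ℝ} {H : MemberY d ℓ hd hL b₀ b₁ Mstar → Prop}
    {P₁ P₂ P₃ P₄ P₅ P₆ P₇ P₈ : ∀ x : MemberY d ℓ hd hL b₀ b₁ Mstar, (bg9Y (Matrix (Fin N) (Fin N) ℂ) (specialUnitaryUnits (Fin N)) x).Cfg → Prop}
    (h36H : ∀ x : MemberY d ℓ hd hL b₀ b₁ Mstar, M₁ ≤ (geo9Y x).M → ∀ α₀ : ℝ, 0 < α₀ → c * (geo9Y x).M * α₀ ≤ a₁ →
      ∀ U : (bg9Y (Matrix (Fin N) (Fin N) ℂ) (specialUnitaryUnits (Fin N)) x).Cfg, (bg9Y (Matrix (Fin N) (Fin N) ℂ) (specialUnitaryUnits (Fin N)) x).Reg335 c α₀ U →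
        P₁ x U ∧ P₂ x U ∧ (P₃ x U ∧ P₄ x U) ∧ (P₅ x U ∧ P₆ x U) ∧ (P₇ x U ∧ P₈ x U)) :
    ∀ x : MemberY d ℓ hd hL b₀ b₁ Mstar, M₁ ≤ (geo9Y x).M → ∀ α₀ : ℝ, 0 < α₀ → c * (geo9Y x).M * α₀ ≤ a₁ →
      ∀ U : (bg9Y (Matrix (Fin N) (Fin N) ℂ) (specialUnitaryUnits (Fin N)) x).Cfg, (bg9Y (Matrix (Fin N) (Fin N) ℂ) (specialUnitaryUnits (Fin N)) x).Reg335 c α₀ U →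
        P₁ x U ∧ P₂ x U ∧ (P₃ x U ∧ P₄ x U ∧ DirTranspose37 (𝔬 x) (𝔡 x) U) ∧ (P₅ x U ∧ P₆ x U ∧ DirSupHolder37 (𝔬 x) (𝔡 x) (𝔭 x) R (H x) U) ∧
          (P₇ x U ∧ P₈ x U ∧ DirSup37 (𝔬 x) (𝔡 x) R (H x) U) := fun x hM α₀ hα₀ ha U hU => by
  obtain ⟨h₁, h₂, ⟨h₃, h₄⟩, ⟨h₅, h₆⟩, ⟨h₇, h₈⟩⟩ := h36H x hM α₀ hα₀ ha U hU
  exact ⟨h₁, h₂, ⟨h₃, h₄, dirTranspose37_memberY x (𝔬 x) (𝔡 x) U hU (h𝔡d x U) (h𝔡s x U)⟩,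
    ⟨h₅, h₆, dirSupHolder37_pinsSA x (𝔬 x) (𝔡 x) (𝔭 x) (Gp x) (parS x) (h𝔭 x) (hblkS x) (hGpS x U) (hDS x U) (h𝔡d x U)⟩,
    ⟨h₇, h₈, dirSup37_pins x (𝔬 x) (𝔡 x) (Gp x) (hblkS x) (hblkYS x) (hGpS x U) (hDS x U) (hDsS x U) (h𝔡d x U) (h𝔡s x U)⟩⟩

/-- ★★ **`h36HA` WITH `DirTranspose310 ∕ DirSupHolder310 ∕ DirSup310` FROM `h36HA` WITHOUT THEM + THE PINS** (bond sector, Theorem 3.10 for `G(U)`; cut bond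
probe carrier `holderProbesKA`). [cite: Balaban1985BackgroundPropagators, p.391 + (3.8) p.392, (3.39)–(3.40) p.397, (3.43) p.398, Thm 3.10 p.416, (3.35) p.396; Balaban1984PropagatorsII, (2.51) p.232] -/
theorem h36HA_of_dir_pins {ιA AA : MemberY d ℓ hd hL b₀ b₁ Mstar → Type}
    (𝔬A : ∀ x : MemberY d ℓ hd hL b₀ b₁ Mstar,
      Ops310 (geo9Y x) (bg9Y (Matrix (Fin N) (Fin N) ℂ) (specialUnitaryUnits (Fin N)) x) (XBK (TrIdx N) x.toKIdx) (XBK (TrIdx N) x.toKIdx) (ιA x) (AA x))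
    (𝔡A : ∀ x : MemberY d ℓ hd hL b₀ b₁ Mstar, DirOps310 (𝔬A x) (Fin (d + 1)))
    (𝔭A : ∀ x : MemberY d ℓ hd hL b₀ b₁ Mstar, HolderProbes (geo9Y x) (bg9Y (Matrix (Fin N) (Fin N) ℂ) (specialUnitaryUnits (Fin N)) x) (XBK (TrIdx N) x.toKIdx)
      (XBK (TrIdx N) x.toKIdx) (PK (FBondY x.toKIdx) (Fin (d + 1)) (TrIdx N)) (PK (FBondY x.toKIdx) (Fin (d + 1)) (TrIdx N)))
    {bI : ∀ x : MemberY d ℓ hd hL b₀ b₁ Mstar, FBondY x.toKIdx → IBondY x.toKIdx}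
    (GA : ∀ x : MemberY d ℓ hd hL b₀ b₁ Mstar, BondOpY (Matrix (Fin N) (Fin N) ℂ) x.toKIdx)
    (parB : ∀ x : MemberY d ℓ hd hL b₀ b₁ Mstar, BondParY (Matrix (Fin N) (Fin N) ℂ) x.toKIdx)
    (h𝔭A : ∀ x : MemberY d ℓ hd hL b₀ b₁ Mstar,
      𝔭A x = holderProbesKA x.toKIdx (trBasis N) (bg9Y (Matrix (Fin N) (Fin N) ℂ) (specialUnitaryUnits (Fin N)) x) (fun U => U) (parB x) (bI x))
    (hblkA : ∀ x : MemberY d ℓ hd hL b₀ b₁ Mstar, (𝔬A x).blk = blkBK x.toKIdx (bI x))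
    (hblkYA : ∀ x : MemberY d ℓ hd hL b₀ b₁ Mstar, (𝔬A x).blkY = blkBK x.toKIdx (bI x))
    (hGcoA : ∀ (x : MemberY d ℓ hd hL b₀ b₁ Mstar) (U : (bg9Y (Matrix (Fin N) (Fin N) ℂ) (specialUnitaryUnits (Fin N)) x).Cfg),
      (𝔬A x).G U = GcoK x.toKIdx (trBasis N) (bg9Y (Matrix (Fin N) (Fin N) ℂ) (specialUnitaryUnits (Fin N)) x) (fun U => U) (GA x) U)
    (hDcoA : ∀ (x : MemberY d ℓ hd hL b₀ b₁ Mstar) (U : (bg9Y (Matrix (Fin N) (Fin N) ℂ) (specialUnitaryUnits (Fin N)) x).Cfg),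
      (𝔬A x).D U = DcoK x.toKIdx (trBasis N) (bg9Y (Matrix (Fin N) (Fin N) ℂ) (specialUnitaryUnits (Fin N)) x) (fun U => U) U)
    (hDscoA : ∀ (x : MemberY d ℓ hd hL b₀ b₁ Mstar) (U : (bg9Y (Matrix (Fin N) (Fin N) ℂ) (specialUnitaryUnits (Fin N)) x).Cfg),
      (𝔬A x).Dstar U = DscoK x.toKIdx (trBasis N) (bg9Y (Matrix (Fin N) (Fin N) ℂ) (specialUnitaryUnits (Fin N)) x) (fun U => U) U)
    (h𝔡Ad : ∀ (x : MemberY d ℓ hd hL b₀ b₁ Mstar) (U : (bg9Y (Matrix (Fin N) (Fin N) ℂ) (specialUnitaryUnits (Fin N)) x).Cfg),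
      (𝔡A x).Dd U = fun μ => coordOpK (trBasis N) (fun _ : Fin (d + 1) => cdBₗ x.toKIdx U μ))
    (h𝔡As : ∀ (x : MemberY d ℓ hd hL b₀ b₁ Mstar) (U : (bg9Y (Matrix (Fin N) (Fin N) ℂ) (specialUnitaryUnits (Fin N)) x).Cfg),
      (𝔡A x).Dsd U = fun μ => coordOpK (trBasis N) (fun _ : Fin (d + 1) => cdsBₗ x.toKIdx U μ))
    {M₁ a₁ c R : ℝ} {H : MemberY d ℓ hd hL b₀ b₁ Mstar → Prop}
    {P₁ P₂ P₃ P₄ P₅ P₆ P₇ P₈ : ∀ x : MemberY d ℓ hd hL b₀ b₁ Mstar, (bg9Y (Matrix (Fin N) (Fin N) ℂ) (specialUnitaryUnits (Fin N)) x).Cfg → Prop}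
    (h36HA : ∀ x : MemberY d ℓ hd hL b₀ b₁ Mstar, M₁ ≤ (geo9Y x).M → ∀ α₀ : ℝ, 0 < α₀ → c * (geo9Y x).M * α₀ ≤ a₁ →
      ∀ U : (bg9Y (Matrix (Fin N) (Fin N) ℂ) (specialUnitaryUnits (Fin N)) x).Cfg, (bg9Y (Matrix (Fin N) (Fin N) ℂ) (specialUnitaryUnits (Fin N)) x).Reg335 c α₀ U →
        P₁ x U ∧ P₂ x U ∧ (P₃ x U ∧ P₄ x U) ∧ (P₅ x U ∧ P₆ x U) ∧ (P₇ x U ∧ P₈ x U)) :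
    ∀ x : MemberY d ℓ hd hL b₀ b₁ Mstar, M₁ ≤ (geo9Y x).M → ∀ α₀ : ℝ, 0 < α₀ → c * (geo9Y x).M * α₀ ≤ a₁ →
      ∀ U : (bg9Y (Matrix (Fin N) (Fin N) ℂ) (specialUnitaryUnits (Fin N)) x).Cfg, (bg9Y (Matrix (Fin N) (Fin N) ℂ) (specialUnitaryUnits (Fin N)) x).Reg335 c α₀ U →
        P₁ x U ∧ P₂ x U ∧ (P₃ x U ∧ P₄ x U ∧ DirTranspose310 (𝔬A x) (𝔡A x) U) ∧ (P₅ x U ∧ P₆ x U ∧ DirSupHolder310 (𝔬A x) (𝔡A x) (𝔭A x) R (H x) U) ∧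
          (P₇ x U ∧ P₈ x U ∧ DirSup310 (𝔬A x) (𝔡A x) R (H x) U) := fun x hM α₀ hα₀ ha U hU => by
  obtain ⟨h₁, h₂, ⟨h₃, h₄⟩, ⟨h₅, h₆⟩, ⟨h₇, h₈⟩⟩ := h36HA x hM α₀ hα₀ ha U hU
  exact ⟨h₁, h₂, ⟨h₃, h₄, dirTranspose310_memberY x (𝔬A x) (𝔡A x) U hU (h𝔡Ad x U) (h𝔡As x U)⟩,
    ⟨h₅, h₆, dirSupHolder310_pinsKA x (𝔬A x) (𝔡A x) (𝔭A x) (GA x) (parB x) (h𝔭A x) (hblkA x) (hGcoA x U) (hDcoA x U) (h𝔡Ad x U)⟩,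
    ⟨h₇, h₈, dirSup310_pins x (𝔬A x) (𝔡A x) (GA x) (hblkA x) (hblkYA x) (hGcoA x U) (hDcoA x U) (hDscoA x U) (h𝔡Ad x U) (h𝔡As x U)⟩⟩


/-! ## v1.1 (append-only) — §3 The slice-constant `G′_□` shape pin gives `DirSupSq37` (R1′'s re-typed `h36`, edition 32) -/

open Literature.MathematicalPhysics.QuantumFieldTheory.Balaban1983to89.B9DirSupAtPins (dirSupSq37_pins)
open Literature.MathematicalPhysics.QuantumFieldTheory.Balaban1983to89.B9Thm37WholeDir (DirSupSq37)

/-- ★★ **`h36` WITH `DirSupSq37` FROM `h36` WITHOUT IT + THE PINS** (R1′: the certificate's re-typed rows-18 binder `h36 : … → Local342 … ∧ DirSupSq37 (𝔬 x) (𝔡 x) 1 (H x) U ∧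
Identities₂ …` of dag-n06-c's `rows131819_definite_geo9Y_pairM_dir`; conjuncts `P Q` abstract): the middle conjunct is dag-n06-w5's `B9DirSupAtPins.dirSupSq37_pins` (p613379) from the
direction ∕ derivative pins `hblkS hblkYS hDS hDsS h𝔡d h𝔡s` and ONE displayed SHAPE pin on the cube Green's functions — every `(𝔬 x).Gsq U j` is a slice-constant coordinate model
`r • coordOpK (trBasis N) (fun _ => G)` (the W-a instance `gsqcoS` is literally of this shape) — for every member and configuration (no regularity needed).
[cite: Balaban1985BackgroundPropagators, Cor. 3.6 p.408 + (3.39) p.397 + (3.42) p.397; Balaban1984PropagatorsII, (2.51) p.232] -/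
theorem h36_of_dirSq_pins {ι : MemberY d ℓ hd hL b₀ b₁ Mstar → Type}
    (𝔬 : ∀ x : MemberY d ℓ hd hL b₀ b₁ Mstar,
      Ops (geo9Y x) (bg9Y (Matrix (Fin N) (Fin N) ℂ) (specialUnitaryUnits (Fin N)) x) (XSK (TrIdx N) x.toKIdx) (XSK (TrIdx N) x.toKIdx) (ι x))
    (𝔡 : ∀ x : MemberY d ℓ hd hL b₀ b₁ Mstar, DirOps37 (𝔬 x) (Fin (d + 1)))
    {bI : ∀ x : MemberY d ℓ hd hL b₀ b₁ Mstar, FBondY x.toKIdx → IBondY x.toKIdx}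
    (hblkS : ∀ x : MemberY d ℓ hd hL b₀ b₁ Mstar, (𝔬 x).blk = blkSK x.toKIdx (sIK x.toKIdx (bI x)))
    (hblkYS : ∀ x : MemberY d ℓ hd hL b₀ b₁ Mstar, (𝔬 x).blkY = blkSK x.toKIdx (sIK x.toKIdx (bI x)))
    (hDS : ∀ (x : MemberY d ℓ hd hL b₀ b₁ Mstar) U, (𝔬 x).D U = DcoS x.toKIdx (trBasis N) (bg9Y (Matrix (Fin N) (Fin N) ℂ) (specialUnitaryUnits (Fin N)) x) (fun U => U) U)
    (hDsS : ∀ (x : MemberY d ℓ hd hL b₀ b₁ Mstar) U,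
      (𝔬 x).Dstar U = DscoS x.toKIdx (trBasis N) (bg9Y (Matrix (Fin N) (Fin N) ℂ) (specialUnitaryUnits (Fin N)) x) (fun U => U) U)
    (h𝔡d : ∀ (x : MemberY d ℓ hd hL b₀ b₁ Mstar) (U : (bg9Y (Matrix (Fin N) (Fin N) ℂ) (specialUnitaryUnits (Fin N)) x).Cfg),
      (𝔡 x).Dd U = fun μ => (etaS x.toKIdx)⁻¹ • coordOpK (trBasis N) (fun _ : Fin (d + 1) => (cdSL x.toKIdx U μ).restrictScalars ℝ))
    (h𝔡s : ∀ (x : MemberY d ℓ hd hL b₀ b₁ Mstar) (U : (bg9Y (Matrix (Fin N) (Fin N) ℂ) (specialUnitaryUnits (Fin N)) x).Cfg),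
      (𝔡 x).Dsd U = fun μ => (etaS x.toKIdx)⁻¹ • coordOpK (trBasis N) (fun _ : Fin (d + 1) => (cdsSL x.toKIdx U μ).restrictScalars ℝ))
    (hGsq : ∀ (x : MemberY d ℓ hd hL b₀ b₁ Mstar) (U : (bg9Y (Matrix (Fin N) (Fin N) ℂ) (specialUnitaryUnits (Fin N)) x).Cfg) (j : ι x),
      ∃ (r : ℝ) (G : (SiteY x.toKIdx → Matrix (Fin N) (Fin N) ℂ) →ₗ[ℝ] (SiteY x.toKIdx → Matrix (Fin N) (Fin N) ℂ)),
        (𝔬 x).Gsq U j = r • coordOpK (trBasis N) (fun _ : Fin (d + 1) => G))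
    {M₁ a₁ c R : ℝ} {H : MemberY d ℓ hd hL b₀ b₁ Mstar → Prop}
    {P Q : ∀ x : MemberY d ℓ hd hL b₀ b₁ Mstar, (bg9Y (Matrix (Fin N) (Fin N) ℂ) (specialUnitaryUnits (Fin N)) x).Cfg → Prop}
    (h36 : ∀ x : MemberY d ℓ hd hL b₀ b₁ Mstar, M₁ ≤ (geo9Y x).M → ∀ α₀ : ℝ, 0 < α₀ → c * (geo9Y x).M * α₀ ≤ a₁ →
      ∀ U : (bg9Y (Matrix (Fin N) (Fin N) ℂ) (specialUnitaryUnits (Fin N)) x).Cfg, (bg9Y (Matrix (Fin N) (Fin N) ℂ) (specialUnitaryUnits (Fin N)) x).Reg335 c α₀ U → P x U ∧ Q x U) :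
    ∀ x : MemberY d ℓ hd hL b₀ b₁ Mstar, M₁ ≤ (geo9Y x).M → ∀ α₀ : ℝ, 0 < α₀ → c * (geo9Y x).M * α₀ ≤ a₁ →
      ∀ U : (bg9Y (Matrix (Fin N) (Fin N) ℂ) (specialUnitaryUnits (Fin N)) x).Cfg, (bg9Y (Matrix (Fin N) (Fin N) ℂ) (specialUnitaryUnits (Fin N)) x).Reg335 c α₀ U → P x U ∧ DirSupSq37 (𝔬 x) (𝔡 x) R (H x) U ∧ Q x U :=
  fun x hM α₀ hα₀ ha U hU =>
    ⟨(h36 x hM α₀ hα₀ ha U hU).1, dirSupSq37_pins x (𝔬 x) (𝔡 x) (hblkS x) (hblkYS x) (hDS x U) (hDsS x U) (h𝔡d x U) (h𝔡s x U) (hGsq x U),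
      (h36 x hM α₀ hα₀ ha U hU).2⟩


/-! ## v1.2 (append-only) — §4 The A-side twin: `DirSupSq310` at the bond pins (R1′-A's re-typed `h36A`, edition 35) — dag-n06-w5's `B9DirSupSqAtPinsA` knit member-∀ -/

open Literature.MathematicalPhysics.QuantumFieldTheory.Balaban1983to89.B9Thm310WholeDir (DirSupSq310)
open Literature.MathematicalPhysics.QuantumFieldTheory.Balaban1983to89.B9DirSupSqAtPinsA (dirSupSq310_pins)

/-- ★★ **`h36A` WITH `DirSupSq310` FROM `h36A` WITHOUT IT + THE BOND PINS** (R1′-A: the certificate's re-typed rows-19 binder `h36A : … → Local342G … ∧ Factors389 … ∧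
DirSupSq310 (𝔬A x) (𝔡A x) 1 (H x) U ∧ Identities310₂ …` of dag-n06-c's `rows131819_definite_geo9Y_pairM_dir₂` (p623265); conjuncts `P Q S` abstract): the third conjunct is
dag-n06-w5's `B9DirSupSqAtPinsA.dirSupSq310_pins` from the pins `hblkA hblkYA hDcoA hDscoA h𝔡Ad h𝔡As` and ONE displayed SHAPE pin `hGsqS` — every `(𝔬A x).Gsq U j` is a
slice-constant coordinate model `r • coordOpK (trBasis N) (fun _ => G)` (no regularity needed).
[cite: Balaban1985BackgroundPropagators, Cor. 3.6 p.408 + (3.39) p.397 + (3.42) p.397 + Thm 3.10 p.416; Balaban1984PropagatorsII, (2.51) p.232] -/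
theorem h36A_of_dirSq_pins {ιA AA : MemberY d ℓ hd hL b₀ b₁ Mstar → Type}
    (𝔬A : ∀ x : MemberY d ℓ hd hL b₀ b₁ Mstar,
      Ops310 (geo9Y x) (bg9Y (Matrix (Fin N) (Fin N) ℂ) (specialUnitaryUnits (Fin N)) x) (XBK (TrIdx N) x.toKIdx) (XBK (TrIdx N) x.toKIdx) (ιA x) (AA x))
    (𝔡A : ∀ x : MemberY d ℓ hd hL b₀ b₁ Mstar, DirOps310 (𝔬A x) (Fin (d + 1)))
    {bI : ∀ x : MemberY d ℓ hd hL b₀ b₁ Mstar, FBondY x.toKIdx → IBondY x.toKIdx}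
    (hblkA : ∀ x : MemberY d ℓ hd hL b₀ b₁ Mstar, (𝔬A x).blk = blkBK x.toKIdx (bI x)) (hblkYA : ∀ x : MemberY d ℓ hd hL b₀ b₁ Mstar, (𝔬A x).blkY = blkBK x.toKIdx (bI x))
    (hDcoA : ∀ (x : MemberY d ℓ hd hL b₀ b₁ Mstar) (U : (bg9Y (Matrix (Fin N) (Fin N) ℂ) (specialUnitaryUnits (Fin N)) x).Cfg), (𝔬A x).D U = DcoK x.toKIdx (trBasis N) (bg9Y (Matrix (Fin N) (Fin N) ℂ) (specialUnitaryUnits (Fin N)) x) (fun U => U) U)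
    (hDscoA : ∀ (x : MemberY d ℓ hd hL b₀ b₁ Mstar) (U : (bg9Y (Matrix (Fin N) (Fin N) ℂ) (specialUnitaryUnits (Fin N)) x).Cfg),
      (𝔬A x).Dstar U = DscoK x.toKIdx (trBasis N) (bg9Y (Matrix (Fin N) (Fin N) ℂ) (specialUnitaryUnits (Fin N)) x) (fun U => U) U)
    (h𝔡Ad : ∀ (x : MemberY d ℓ hd hL b₀ b₁ Mstar) (U : (bg9Y (Matrix (Fin N) (Fin N) ℂ) (specialUnitaryUnits (Fin N)) x).Cfg), (𝔡A x).Dd U = fun μ => coordOpK (trBasis N) (fun _ : Fin (d + 1) => cdBₗ x.toKIdx U μ))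
    (h𝔡As : ∀ (x : MemberY d ℓ hd hL b₀ b₁ Mstar) (U : (bg9Y (Matrix (Fin N) (Fin N) ℂ) (specialUnitaryUnits (Fin N)) x).Cfg), (𝔡A x).Dsd U = fun μ => coordOpK (trBasis N) (fun _ : Fin (d + 1) => cdsBₗ x.toKIdx U μ))
    (hGsqS : ∀ (x : MemberY d ℓ hd hL b₀ b₁ Mstar) (U : (bg9Y (Matrix (Fin N) (Fin N) ℂ) (specialUnitaryUnits (Fin N)) x).Cfg) (j : ιA x),
      ∃ (r : ℝ) (G : (FBondY x.toKIdx → Matrix (Fin N) (Fin N) ℂ) →ₗ[ℝ] (FBondY x.toKIdx → Matrix (Fin N) (Fin N) ℂ)),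
        (𝔬A x).Gsq U j = r • coordOpK (trBasis N) (fun _ : Fin (d + 1) => G))
    {M₁ a₁ c R : ℝ} {H : MemberY d ℓ hd hL b₀ b₁ Mstar → Prop}
    {P Q S : ∀ x : MemberY d ℓ hd hL b₀ b₁ Mstar, (bg9Y (Matrix (Fin N) (Fin N) ℂ) (specialUnitaryUnits (Fin N)) x).Cfg → Prop}
    (h36A : ∀ x : MemberY d ℓ hd hL b₀ b₁ Mstar, M₁ ≤ (geo9Y x).M → ∀ α₀ : ℝ, 0 < α₀ → c * (geo9Y x).M * α₀ ≤ a₁ →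
      ∀ U : (bg9Y (Matrix (Fin N) (Fin N) ℂ) (specialUnitaryUnits (Fin N)) x).Cfg, (bg9Y (Matrix (Fin N) (Fin N) ℂ) (specialUnitaryUnits (Fin N)) x).Reg335 c α₀ U → P x U ∧ Q x U ∧ S x U) :
    ∀ x : MemberY d ℓ hd hL b₀ b₁ Mstar, M₁ ≤ (geo9Y x).M → ∀ α₀ : ℝ, 0 < α₀ → c * (geo9Y x).M * α₀ ≤ a₁ →
      ∀ U : (bg9Y (Matrix (Fin N) (Fin N) ℂ) (specialUnitaryUnits (Fin N)) x).Cfg, (bg9Y (Matrix (Fin N) (Fin N) ℂ) (specialUnitaryUnits (Fin N)) x).Reg335 c α₀ U → P x U ∧ Q x U ∧ DirSupSq310 (𝔬A x) (𝔡A x) R (H x) U ∧ S x U :=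
  fun x hM α₀ hα₀ ha U hU =>
    ⟨(h36A x hM α₀ hα₀ ha U hU).1, (h36A x hM α₀ hα₀ ha U hU).2.1,
      dirSupSq310_pins x (𝔬A x) (𝔡A x) (hblkA x) (hblkYA x) (hDcoA x U) (hDscoA x U) (h𝔡Ad x U) (h𝔡As x U) (hGsqS x U),
      (h36A x hM α₀ hα₀ ha U hU).2.2⟩

end Summit.QuantumFields.YangMills.BalabanUVNodes.N06DirKinematicsAtPins

end
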